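import Literature.AnabelianGeometry.EtaleTheta.Discharge.Sec1Prop15QuotOfYCoordKit
import Literature.AnabelianGeometry.EtaleTheta.Discharge.Sec1Prop15OfYCoordKit
import HarnessLib

/-!
# [EtTh] Prop. 1.5 (i)(ii) — ALL FOUR typed clauses («log ∈ F¹», filtration, «= Ẑ·log», both sides) at ANY section
# Kummer datum of ANY Kummer core fed by a `y`-coordinate kit: ONE generic closer (proof-only)

S. Mochizuki, *The étale theta function and its Frobenioid-theoretic manifestations*, Publ. RIMS **45** (2009) [EtTh], §1,
Prop. 1.5 (i)(ii), PRIMS PDF p. 23 (printed 249) [cite: MochizukiEtTh2009, Prop 1.5 (ii) p.23].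

abc-iut cell, layer L2, seat abc-iut-L2-t6 (gen 7), row «PROP15-QUOT FROM A Y-COORDINATE KIT», generic file 2.
PROOF-ONLY (0 `def`). Joins abc-iut-L6-d5/w5-d171's kit assembly `KummerCore.prop15i_and_prop15ii_ofSection_of_kit`
(`Discharge/Sec1Prop15OfYCoordKit`: the frozen `Prop15i` ∧ `Prop15ii` at a section datum from a kit, `ŷ|_{Δ_Θ} = 1` and one
`Θ`-lift) with this seat's `YCoordKit.prop15iQuot_of_laws` / `prop15iiQuot_of_laws` (`Discharge/Sec1Prop15QuotOfYCoordKit`: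
abc-iut-L2-t1's identifications `Prop15iQuot` ∧ `Prop15iiQuot` from the kit laws) into

* **`KummerCore.prop15_four_ofSection_of_kit`** — `Prop15i ∧ Prop15ii ∧ Prop15iQuot ∧ Prop15iiQuot` at
  `C.toKummerDataOfSection s …` for ANY theta setting with `HasThetaTopology` and `IsEtThOrigin`, ANY Kummer core `C` whose
  `log(U)`, `log(Ü)` are the kit classes, from: the kit laws {`χ^Θ|_Δ = 1`, `ŷ = 1 ↔ ∈ Δ_Θ` on `(Δ^tp_Y)^Θ`, `ŷ` onto `Ẑ` on
  `(Δ^tp_Y)^Θ` and onto the squares on `(Δ^tp_Ÿ)^Θ`, `ι` bijective} and ONE `Θ`-lift `x` of `log(Θ)` to `(Π^tp_Y)^Θ`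
  (the clause `ŷ|_{Δ_Θ} = 1` of the frozen assembly is a COROLLARY of the kernel law, `YCoordKit.y_eq_one_of_mem_deltaTheta`);
* `KummerCore.prop15_four_of_kit` — the same for ANY Kummer datum `E` carrying the kit classes, given `Prop15i E ∧ Prop15ii E`.
Every later model (cusped, Tate-sheared, …) instantiates Prop. 1.5 (i)(ii) in full by discharging the kit laws once.
Nothing of [EtTh] asserted; no side taken on [IUTchIII] Cor. 3.12; typed ≠ proved.
-/

noncomputable section

namespace Literature.AnabelianGeometry.EtaleTheta

open Literature.AnabelianGeometry.SemiGraphs _root_.Function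
open scoped IsMulCommutative

namespace ThetaSetting

variable {p : ℕ} [Fact p.Prime] {D : ThetaSetting p}

/-- **`ŷ|_{Δ_Θ} = 1` from the kernel law** (`Δ_Θ ≤ (Δ^tp_Y)^Θ` by `Compat`). [cite: MochizukiEtTh2009, Prop 1.5 (i) p.23] -/
theorem YCoordKit.y_eq_one_of_mem_deltaTheta (K : D.YCoordKit) (hC : D.Compat)
    (hker : ∀ g ∈ D.DtpYTheta, K.y g = 1 ↔ g ∈ D.DeltaTheta) (d : D.GtpTheta) (hd : d ∈ D.DeltaTheta) : K.y d = 1 :=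
  (hker d (hC.deltaTheta_le_DtpYTheta hd)).mpr hd

namespace KummerCore

variable (C : D.KummerCore) (K : D.YCoordKit)
  (s : GQp p →* D.PiTemp) (hs : Continuous s) (hsec : ∀ σ, D.aug (s σ) = σ)
  (hsY : D.GK.map s ≤ D.GtpY) (hsYdd : D.GKdd.map s ≤ D.GtpYdd)

/-- **[EtTh] Prop. 1.5 (i) ∧ (ii), ALL FOUR typed clauses at a section Kummer datum from a `y`-coordinate kit**:
`Prop15i ∧ Prop15ii ∧ Prop15iQuot ∧ Prop15iiQuot` at `C.toKummerDataOfSection s …`, from the kit laws and one `Θ`-lift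
of `log(Θ)` — at any setting with the census topology predicate and of [EtTh] origin.
[cite: MochizukiEtTh2009, Prop 1.5 (ii) p.23] -/
theorem prop15_four_ofSection_of_kit (hC : D.Compat) (hT : D.HasThetaTopology) (hO : D.IsEtThOrigin)
    (hKU : C.logU = K.logU) (hKUdd : C.logUdd = K.logUdd)
    (hχ : ∀ g ∈ D.DeltaTemp.map D.toTheta, K.chiT g = 1)
    (hker : ∀ g ∈ D.DtpYTheta, K.y g = 1 ↔ g ∈ D.DeltaTheta)
    (hY : ∀ t : SettingModel.ZH, ∃ g ∈ D.DtpYTheta, K.y g = t)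
    (hYdd : ∀ s : SettingModel.ZH, ∃ g ∈ (D.DtpYddN 1).map D.toTheta, K.y g = s ^ 2) (hι : Bijective K.iota)
    (x : D.H1Theta (D.GtpY.map D.toTheta))
    (hx : ContH1.res (MonoidHom.id D.GtpTheta) D.DeltaTheta
      (hC.deltaTheta_le_DtpYTheta.trans (Subgroup.map_mono inf_le_left)) x = D.logTheta) :
    Prop15i (C.toKummerDataOfSection s hs hsec hsY hsYdd) hC ∧ Prop15ii (C.toKummerDataOfSection s hs hsec hsY hsYdd) hC ∧
      Prop15iQuot (C.toKummerDataOfSection s hs hsec hsY hsYdd) hC ∧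
        Prop15iiQuot (C.toKummerDataOfSection s hs hsec hsY hsYdd) hC := by
  haveI := hT.t2Space_gtpTheta
  have h12 := C.prop15i_and_prop15ii_ofSection_of_kit K s hs hsec hsY hsYdd hC hKU hKUdd
    (K.y_eq_one_of_mem_deltaTheta hC hker) x hx
  have h34 := K.prop15iQuot_and_prop15iiQuot_of_laws hC hT hO hχ hker hY hYdd hι
    (E := C.toKummerDataOfSection s hs hsec hsY hsYdd) hKU hKUdd
  exact ⟨h12.1, h12.2, h34.1, h34.2⟩

end KummerCore

/-- **The same four clauses for ANY Kummer datum carrying the kit classes**, given the frozen `Prop15i ∧ Prop15ii` there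
(e.g. abc-iut-w5-d140's `prop15ii_of_section`, or the core data `toKummerData` where they hold).
[cite: MochizukiEtTh2009, Prop 1.5 (ii) p.23] -/
theorem YCoordKit.prop15_four_of_laws (K : D.YCoordKit) (hC : D.Compat) (hT : D.HasThetaTopology) (hO : D.IsEtThOrigin)
    (hχ : ∀ g ∈ D.DeltaTemp.map D.toTheta, K.chiT g = 1)
    (hker : ∀ g ∈ D.DtpYTheta, K.y g = 1 ↔ g ∈ D.DeltaTheta)
    (hY : ∀ t : SettingModel.ZH, ∃ g ∈ D.DtpYTheta, K.y g = t)
    (hYdd : ∀ s : SettingModel.ZH, ∃ g ∈ (D.DtpYddN 1).map D.toTheta, K.y g = s ^ 2) (hι : Bijective K.iota)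
    {E : D.KummerData} (hU : E.logU = K.logU) (hUdd : E.logUdd = K.logUdd) (h12 : Prop15i E hC ∧ Prop15ii E hC) :
    Prop15i E hC ∧ Prop15ii E hC ∧ Prop15iQuot E hC ∧ Prop15iiQuot E hC :=
  have h34 := K.prop15iQuot_and_prop15iiQuot_of_laws hC hT hO hχ hker hY hYdd hι hU hUdd
  ⟨h12.1, h12.2, h34.1, h34.2⟩

end ThetaSetting

end Literature.AnabelianGeometry.EtaleTheta

end
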